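import Summits.Ventures.HSemireg.Pad4TowerAlphabetMu4
import Summits.Ventures.HSemireg.Pad4TowerXInfA

/-!
# Venture HSemireg — PAD-4: THEOREM X∞ on 𝔅(μ₄) (all four phases), part A — LEMMA X∞-A and COROLLARY A′ in the kernel

HONEST FRAMING. Second of four files (see `Pad4TowerAlphabetMu4`); seat `hodge-semireg-assembly-p1` g1; source bc5-plan g4 memo v4.1
§2–§3 (pencil ×1; LEG A s4-ref-2 g13 cce93bb8701bf60e, LEG B s4-ref g74 25db25abe3d97279 on the bus). THIS FILE proves, natively on
𝔅(μ₄) and with typer-2's RULE D (`Pad4TowerRuleDMu4`, used through its engine `settledBelow_of_O` = (R-O) and directly):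
* `xinfMu4A_N` ∕ `xinfMu4A_P` ∕ `xinfMu4A` ∕ `no_mixedMu4` — **LEMMA X∞-A on 𝔅(μ₄)**: in a RULE-D-closed, PSC, X-clean configuration
  with `P`-letters in `𝒰`, no cell of either level carries an O-letter, a pure ray `c·ℓ_u` and a further charged letter. Strong
  induction on the ray height: (N_c) [(R-O) serves the ray factor; below a ray only the own direction exists (`below_lpt`); a server
  of positive charge is a `Mixed` `P` of smaller charge, so the server is the full cancellation (x1); intermediate own rays and
  `w`-companions likewise absent (x1)(x3); PSC gives the sibling `Z[σ ↦ c·ℓ_{u·i}]` (x2); `XCleanMu4` forbids exactly this]; (P_c)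
  [every server ∕ cover above the further factors — IN ANY OF THE FOUR DIRECTIONS, including the servers `e·ℓ_r` of an O-factor —
  keeps an O-factor, the ray and a charged letter: a `Mixed` `N` of the same ray height; CASE A: RULE D equates all adapted
  coordinates of the two charged factors, impossible in `𝒰`; CASE B: the pair (O-coordinate, charged coordinate) is stuck].
* `no_O_biChargedMu4_N` ∕ `_P` — **COROLLARY A′ on 𝔅(μ₄)**: no cell with an O-factor is charged on two further factors [N: the
  charged letters are towers; (R-O) at the antipodal coordinate `2` plus the move table (`below_towPt`) gives the antipodal partner
  carrying the pure ray `(c+1)·ℓ_u`, a `Mixed` `P`; P: RULE D at (own `2c+2`, antipodal `2`) — every server ∕ cover above is an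
  `N` excluded by the `N`-side, whatever its direction].
* `AdmissibleMu4.atMostOne`, `.fc_of_agree` (partners of fully charged cells are fully charged), `.junk_or_fc` (every cell of an
  admissible configuration is junk OR fully charged — `Pad4TowerXInfMu4` removes the second alternative).
Compared with the (F1ℝ) files the μ₄ proofs are SHORTER: the O-factor steps are direction-blind, and the `P`-side of A′ needs no
alphabet fact. Hypotheses are exactly `RuleDMu4Closed`, `PSCMu4`, `XCleanMu4`, letters in `InUMu4` (where used).

WHAT IS NOT HERE ∕ NOT IN LEAN: LEMMA X∞-B and the theorem's conclusion (file `Pad4TowerXInfMu4`); the (E1) meaning of the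
predicates (pencil). Nothing is a statement about a variety, a sheaf, `σ`, a seed or an abelian variety; NOTHING HERE SAYS THAT
HC ∕ HC_CM ∕ HC_AV ∕ W₆ ∕ HC_Kum4Type HOLDS OR FAILS. No `instance`, no notation, no named fact, 0 `sorry`; axioms standard.

SOURCES (sha16): BC5-PLAN-g4-MEMO.md v4.1 df3e4f41db3c2fcf §1–§3, §6; `Pad4TowerAlphabetMu4.lean` (this seat, same filing);
`Pad4TowerRuleDMu4.lean` 7f3a78a9d76f5e0c; `Pad4TowerXInfA.lean` 69fd0bbeca40d0fc (the (F1ℝ) proof this file parallels; `exists_fourth`).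
-/

namespace Summit.Ventures.HSemireg.Pad4Tower

open Finset

/-! ## §3 LEMMA X∞-A on 𝔅(μ₄): no `Mixed` cell on either level (memo v4.1 §2, induction on the ray charge) -/

section XinfA
variable {C : MConfig} (hD : RuleDMu4Closed C) (hS : PSCMu4 C) (hX : XCleanMu4 C)
  (hUP : ∀ P ∈ C.upper, ∀ f, InUMu4 (P f))

/-- the `w`-companions ∕ intermediate own rays `Z[σ ↦ c′·ℓ_w]` (`c′ ≥ 1`) of a `Mixed` cell are `Mixed`. -/
theorem mixedMu4_update {Z : MCell} {f σ g : Fin 4} (hO : Z f = (0, 0, 0)) (hσf : σ ≠ f) (hgf : g ≠ f) (hgσ : g ≠ σ)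
    (hg : Z g ≠ (0, 0, 0)) {c' : ℤ} (h1 : 1 ≤ c') (w : Fin 4) : MixedMu4 (Function.update Z σ (lpt c' w)) f σ :=
  ⟨by rw [Function.update_of_ne hσf.symm]; exact hO, ⟨c', h1, w, Function.update_self ..⟩, g, hgf, hgσ,
    by rw [Function.update_of_ne hgσ]; exact hg⟩

include hD hS hX hUP in
/-- **(N_c)**: if no `P`-cell of ray height `< n` is `Mixed`, no `N`-cell of ray height `≤ n` is. [(R-O) of
`Pad4TowerRuleDMu4` at the pair (ray coordinate `2c`, O-coordinate `0`) gives a server of `σ`; below a ray only the own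
direction exists (`below_lpt`); a server of positive charge would be a `Mixed` `P` of smaller charge, so the server is the full
cancellation (x1); the intermediate own rays and `w`-companions are absent for the same reason (x1)(x3); PSC supplies the sibling
`Z[σ ↦ c·ℓ_{u·i}]` (x2); X-cleanness forbids exactly this.] -/
theorem xinfMu4A_N {n : ℕ} (ih : ∀ P ∈ C.upper, ∀ f σ, (P σ).1 < n → ¬ MixedMu4 P f σ)
    {Z : MCell} (hZ : Z ∈ C.lower) {f σ : Fin 4} (hn : (Z σ).1 ≤ n) (hm : MixedMu4 Z f σ) : False := by
  obtain ⟨hO, ⟨c, hc, k, hZσ⟩, g, hgf, hgσ, hg⟩ := hm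
  have hσf : σ ≠ f := fun h => lpt_ne_O hc k (by rw [← hZσ, h, hO])
  have hcone : ∀ P ∈ C.upper, ∀ f, Effective (P f) := fun P hP f => (hUP P hP f).effective
  obtain ⟨r, -, P, hPu, hag, hlt, hray⟩ :=
    settledBelow_of_O (hD.1 Z hZ) hcone hO hσf (by rw [hZσ]; exact (frame_lpt c k).1)
      (by rw [hZσ, (frame_lpt c k).2.2.1]; omega)
  rw [hZσ] at hlt hray hn
  obtain ⟨-, hPσ, hP0⟩ := below_lpt hc (hUP P hPu σ) hlt hray
  have hcZ : (lpt c k).1 = c := by rw [lpt_eq]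
  rw [hcZ] at hlt hn
  -- the server is the full cancellation
  have hPσ0 : (P σ).1 = 0 := by
    by_contra hne
    exact ih P hPu f σ (by omega)
      ⟨(hag f hσf.symm).trans hO, ⟨(P σ).1, by omega, k, hPσ⟩, g, hgf, hgσ, by rw [hag g hgσ]; exact hg⟩
  have hq : Function.update Z σ (0, 0, 0) ∈ C.upper := by
    have : P = Function.update Z σ (0, 0, 0) := by
      funext g'
      by_cases hg' : g' = σ
      · subst hg'; rw [Function.update_self, hPσ, hPσ0, lpt_zero]
      · rw [Function.update_of_ne hg', hag g' hg']
    exact this ▸ hPu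
  refine hX Z hZ f σ hσf hO k c hc hZσ ⟨hq, k - 3, by fin_cases k <;> decide, fun c' h1 hlt' => ⟨fun hmem => ?_, fun hmem => ?_⟩, ?_⟩
  · exact ih _ hmem f σ (by rw [Function.update_self, lpt_eq]; simp only; omega) (mixedMu4_update hO hσf hgf hgσ hg h1 k)
  · exact ih _ hmem f σ (by rw [Function.update_self, lpt_eq]; simp only; omega)
      (mixedMu4_update hO hσf hgf hgσ hg h1 (k - 3))
  · have := hS Z hZ ⟨f, hO⟩ σ 3
    rwa [hZσ, rotPt_lpt] at this

include hD hUP in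
/-- **(P_c)**: if no `N`-cell of ray height `≤ n` is `Mixed`, no `P`-cell of ray height `≤ n` is. [Every server ∕ cover above
the further factors keeps the O-factor, the ray and a charged letter: a `Mixed` `N` of the same ray height — WHATEVER ITS
DIRECTION (the μ₄ proof is direction-blind here, including the servers `e·ℓ_r`, `r ∈ μ₄`, of an O-factor); CASE A (two further
charged factors): RULE D forces all their adapted coordinates to agree, impossible for a charged letter of `𝒰`
(`InUMu4.exists_coords_ne`); CASE B (a second O-factor): the pair (O-coordinate `0`, charged coordinate `≠ 0`) has neither
server nor cover.] -/
theorem xinfMu4A_P {n : ℕ} (hN : ∀ Z ∈ C.lower, ∀ f σ, (Z σ).1 ≤ n → ¬ MixedMu4 Z f σ)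
    {P : MCell} (hPu : P ∈ C.upper) {f σ : Fin 4} (hn : (P σ).1 ≤ n) (hm : MixedMu4 P f σ) : False := by
  obtain ⟨hO, ⟨c, hc, k, hPσ⟩, g, hgf, hgσ, hg⟩ := hm
  have hσf : σ ≠ f := fun h => lpt_ne_O hc k (by rw [← hPσ, h, hO])
  obtain ⟨h, hhf, hhσ, hhg⟩ := exists_fourth f σ g
  have hP0 : ∀ g', 0 ≤ (P g').1 := fun g' => (hUP P hPu g').fst_nonneg
  -- an `N` above `P` agreeing with it on `σ` and on an O-factor `o`, charged on a factor `k₁ ∉ {o, σ}`, is a Mixed N of height ≤ n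
  have key : ∀ N ∈ C.lower, ∀ o, o ≠ σ → P o = (0, 0, 0) → N o = P o → N σ = P σ →
      ∀ k₁, k₁ ≠ o → k₁ ≠ σ → N k₁ ≠ (0, 0, 0) → False := fun N hNl o _ hoO hNo hNσ k₁ hk₁o hk₁σ hk₁ =>
    hN N hNl o σ (by rw [hNσ]; exact hn) ⟨hNo.trans hoO, ⟨c, hc, k, hNσ.trans hPσ⟩, k₁, hk₁o, hk₁σ, hk₁⟩
  by_cases hhO : P h = (0, 0, 0)
  · -- CASE B: the pair ((f, ·) = 0, (g, ·) ≠ 0)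
    obtain ⟨kg, hadg, hcg⟩ := (hUP P hPu g).exists_coord_ne_zero hg
    rcases hD.2 P hPu f g hgf.symm 0 kg (by rw [hO]; exact adapted_O 0) hadg
        (by rw [hO, coord_O]; exact hcg.symm) with
        ⟨r, -, N, hNl, hag, hlt, -⟩ | ⟨r, -, N, hNl, hag, hlt, -⟩ | ⟨a, b, -, -, N, hNl, hag, -, -, hltg, -⟩
    · exact key N hNl h hhσ hhO (hag h hhf).symm (hag σ hσf).symm g hhg.symm hgσ
        (by rw [← hag g hgf]; exact hg)
    · exact key N hNl f hσf.symm hO (hag f hgf.symm).symm (hag σ hgσ.symm).symm g hgf hgσ (ne_O_of_lt (hP0 g) hlt)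
    · exact key N hNl h hhσ hhO (hag h hhf hhg) (hag σ hσf hgσ.symm) g hhg.symm hgσ (ne_O_of_lt (hP0 g) hltg)
  · -- CASE A: all adapted coordinates of `g` and `h` agree
    have hall : ∀ k₁ k₂, Adapted (P g) k₁ → Adapted (P h) k₂ → coord (P g) k₁ = coord (P h) k₂ := by
      intro k₁ k₂ had₁ had₂
      by_contra hne
      rcases hD.2 P hPu g h hhg.symm k₁ k₂ had₁ had₂ hne with
          ⟨r, -, N, hNl, hag, hlt, -⟩ | ⟨r, -, N, hNl, hag, hlt, -⟩ | ⟨a, b, -, -, N, hNl, hag, hltg, -, -, -⟩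
      · exact key N hNl f hσf.symm hO (hag f hgf.symm).symm (hag σ hgσ.symm).symm g hgf hgσ (ne_O_of_lt (hP0 g) hlt)
      · exact key N hNl f hσf.symm hO (hag f hhf.symm).symm (hag σ hhσ.symm).symm h hhf hhσ (ne_O_of_lt (hP0 h) hlt)
      · exact key N hNl f hσf.symm hO (hag f hgf.symm hhf.symm) (hag σ hgσ.symm hhσ.symm) g hgf hgσ
          (ne_O_of_lt (hP0 g) hltg)
    obtain ⟨k₁, had₁, had₁', hne⟩ := (hUP P hPu g).exists_coords_ne hg
    obtain ⟨k₂, had₂, -⟩ := (hUP P hPu h).exists_coord_ne_zero hhO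
    exact hne ((hall k₁ k₂ had₁ had₂).trans (hall (k₁ + 2) k₂ had₁' had₂).symm)

include hD hS hX hUP in
/-- **LEMMA X∞-A on 𝔅(μ₄)** (bc5-plan g4 memo v4.1 §2, all four phases): in a RULE-D-closed, PSC, X-clean configuration with
`P`-letters in `𝒰`, no cell of either level carries an O-letter, a pure-ray letter and a further charged letter. Strong induction on
the ray height in the order (N_1), (P_1), (N_2), (P_2), … . -/
theorem xinfMu4A (n : ℕ) :
    (∀ Z ∈ C.lower, ∀ f σ, (Z σ).1 ≤ n → ¬ MixedMu4 Z f σ) ∧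
      (∀ P ∈ C.upper, ∀ f σ, (P σ).1 ≤ n → ¬ MixedMu4 P f σ) := by
  induction n using Nat.strong_induction_on with
  | _ n ih =>
    have hN : ∀ Z ∈ C.lower, ∀ f σ, (Z σ).1 ≤ n → ¬ MixedMu4 Z f σ := fun Z hZ f σ hn hm =>
      xinfMu4A_N hD hS hX hUP (n := n) (fun P hPu f' σ' hlt hm' => by
        rcases Nat.eq_zero_or_pos n with h0 | hpos
        · obtain ⟨-, ⟨c', hc', k', hP⟩, -⟩ := hm'
          rw [hP, lpt_eq] at hlt; simp only at hlt; omega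
        · exact (ih (n - 1) (by omega)).2 P hPu f' σ' (by omega) hm') hZ hn hm
    exact ⟨hN, fun P hPu f σ hn hm => xinfMu4A_P hD hUP hN hPu hn hm⟩

include hD hS hX hUP in
/-- LEMMA X∞-A on 𝔅(μ₄), unindexed form. -/
theorem no_mixedMu4 : (∀ Z ∈ C.lower, ∀ f σ, ¬ MixedMu4 Z f σ) ∧ (∀ P ∈ C.upper, ∀ f σ, ¬ MixedMu4 P f σ) :=
  ⟨fun Z hZ f σ => (xinfMu4A hD hS hX hUP (Z σ).1.toNat).1 Z hZ f σ (Int.self_le_toNat _),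
    fun P hPu f σ => (xinfMu4A hD hS hX hUP (P σ).1.toNat).2 P hPu f σ (Int.self_le_toNat _)⟩

end XinfA

/-! ## §4 COROLLARY A′ on 𝔅(μ₄): no cell with an O-letter is charged on two further factors (memo v4.1 §3) -/

section CorA
variable {C : MConfig} (hD : RuleDMu4Closed C) (hS : PSCMu4 C) (hX : XCleanMu4 C)
  (hUN : ∀ Z ∈ C.lower, ∀ f, InUMu4 (Z f)) (hUP : ∀ P ∈ C.upper, ∀ f, InUMu4 (P f))

include hD hS hX hUN hUP in
/-- **COROLLARY A′, `N`-side**: no `N`-cell with an O-factor is charged on two further factors. [A charged non-ray letter of `𝒰`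
is a tower; (R-O) at its antipodal coordinate `2` gives a server below in a direction `≠` own; below a tower inside `𝒰` that is
the antipodal unit step to the pure ray `(c+1)·ℓ_u` (`below_towPt`) — a `Mixed` `P`, excluded by LEMMA X∞-A.] -/
theorem no_O_biChargedMu4_N {Z : MCell} (hZ : Z ∈ C.lower) {f j k : Fin 4} (hO : Z f = (0, 0, 0)) (hjf : j ≠ f)
    (hkf : k ≠ f) (hjk : j ≠ k) (hj : Z j ≠ (0, 0, 0)) (hk : Z k ≠ (0, 0, 0)) : False := by
  have hnm := no_mixedMu4 hD hS hX hUP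
  obtain ⟨u, c, hc, hZj⟩ : ∃ u : Fin 4, ∃ c : ℤ, 1 ≤ c ∧ Z j = towPt c u := by
    rcases (inUMu4_iff _).1 (hUN Z hZ j) with h0 | ⟨u, c, hc, h | h⟩
    · exact absurd h0 hj
    · exact (hnm.1 Z hZ f j ⟨hO, ⟨c, hc, u, h⟩, k, hkf, hjk.symm, hk⟩).elim
    · exact ⟨u, c, hc, h⟩
  have hcone : ∀ P ∈ C.upper, ∀ f, Effective (P f) := fun P hP f => (hUP P hP f).effective
  obtain ⟨r, hr, P, hPu, hag, hlt, hray⟩ := settledBelow_of_O (hD.1 Z hZ) hcone hO hjf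
    (by rw [hZj]; exact (frame_towPt c u).2.1) (by rw [hZj, (frame_towPt c u).2.2.2]; decide)
  rw [hZj] at hlt hray
  replace hr : r ≠ u := by omega
  obtain ⟨-, hPj⟩ := below_towPt hc (hUP P hPu j) hlt hray hr
  exact hnm.2 P hPu f j
    ⟨(hag f hjf.symm).trans hO, ⟨c + 1, by omega, u, hPj⟩, k, hkf, hjk.symm, by rw [hag k hjk.symm]; exact hk⟩

include hD hS hX hUN hUP in
/-- **COROLLARY A′, `P`-side**: no `P`-cell with an O-factor is charged on two further factors. [Both charged letters are towers
(a ray would be `Mixed`); RULE D at the pair (own coordinate `2c+2 ≥ 4` of one, antipodal coordinate `2` of the other): every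
server or cover above keeps the O-factor and both charged factors — an `N` excluded by the `N`-side, whatever the direction.] -/
theorem no_O_biChargedMu4_P {P : MCell} (hPu : P ∈ C.upper) {f j k : Fin 4} (hO : P f = (0, 0, 0)) (hjf : j ≠ f)
    (hkf : k ≠ f) (hjk : j ≠ k) (hj : P j ≠ (0, 0, 0)) (hk : P k ≠ (0, 0, 0)) : False := by
  have hnm := (no_mixedMu4 hD hS hX hUP).2 P hPu
  have tower : ∀ g k' : Fin 4, g ≠ f → k' ≠ f → g ≠ k' → P g ≠ (0, 0, 0) → P k' ≠ (0, 0, 0) →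
      ∃ u : Fin 4, ∃ c : ℤ, 1 ≤ c ∧ P g = towPt c u := by
    intro g k' hgf hk'f hgk' hg hk'
    rcases (inUMu4_iff _).1 (hUP P hPu g) with h0 | ⟨u, c, hc, h | h⟩
    · exact absurd h0 hg
    · exact (hnm f g ⟨hO, ⟨c, hc, u, h⟩, k', hk'f, hgk'.symm, hk'⟩).elim
    · exact ⟨u, c, hc, h⟩
  obtain ⟨uj, cj, hcj, hPj⟩ := tower j k hjf hkf hjk hj hk
  obtain ⟨uk, ck, hck, hPk⟩ := tower k j hkf hjf hjk.symm hk hj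
  have hP0 : ∀ g', 0 ≤ (P g').1 := fun g' => (hUP P hPu g').fst_nonneg
  have hNx := fun {N : MCell} (hNl : N ∈ C.lower) => no_O_biChargedMu4_N hD hS hX hUN hUP hNl (f := f) (j := j) (k := k)
  rcases hD.2 P hPu j k hjk uj (uk + 2) (by rw [hPj]; exact (frame_towPt cj uj).1)
      (by rw [hPk]; exact (frame_towPt ck uk).2.1)
      (by rw [hPj, hPk, (frame_towPt cj uj).2.2.1, (frame_towPt ck uk).2.2.2]; omega) with
      ⟨r, -, N, hNl, hag, hlt, -⟩ | ⟨r, -, N, hNl, hag, hlt, -⟩ | ⟨a, b, -, -, N, hNl, hag, hltj, -, hltk, -⟩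
  · exact hNx hNl ((hag f hjf.symm).symm.trans hO) hjf hkf hjk (ne_O_of_lt (hP0 j) hlt)
      (by rw [← hag k hjk.symm]; exact hk)
  · exact hNx hNl ((hag f hkf.symm).symm.trans hO) hjf hkf hjk (by rw [← hag j hjk]; exact hj)
      (ne_O_of_lt (hP0 k) hlt)
  · exact hNx hNl ((hag f hjf.symm hkf.symm).trans hO) hjf hkf hjk (ne_O_of_lt (hP0 j) hltj) (ne_O_of_lt (hP0 k) hltk)

end CorA

/-! ## §5 Consequences for admissible configurations: at most one charged factor next to an `O`; partners of FC cells are FC -/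

/-- COROLLARY A′ in use: in an admissible 𝔅(μ₄) configuration a cell (either level) with an O-factor has at most one charged
factor. -/
theorem AdmissibleMu4.atMostOne {C : MConfig} (hA : AdmissibleMu4 C) {X : MCell} (hX : X ∈ C.lower ∨ X ∈ C.upper)
    {f j k : Fin 4} (hO : X f = (0, 0, 0)) (hjf : j ≠ f) (hkf : k ≠ f) (hjk : j ≠ k) (hj : X j ≠ (0, 0, 0))
    (hk : X k ≠ (0, 0, 0)) : False := by
  rcases hX with h | h
  · exact no_O_biChargedMu4_N hA.ruleD hA.psc hA.xclean hA.uN hA.uP h hO hjf hkf hjk hj hk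
  · exact no_O_biChargedMu4_P hA.ruleD hA.psc hA.xclean hA.uN hA.uP h hO hjf hkf hjk hj hk

/-- **partners of fully charged cells are fully charged** (memo §3, second sentence): a cell of an admissible configuration
agreeing with a fully charged cell on two whole factors is fully charged. -/
theorem AdmissibleMu4.fc_of_agree {C : MConfig} (hA : AdmissibleMu4 C) {X Y : MCell} (hY : Y ∈ C.lower ∨ Y ∈ C.upper)
    (hX : FCMu4 X) {a b : Fin 4} (hab : a ≠ b) (ha : Y a = X a) (hb : Y b = X b) : FCMu4 Y := by
  intro f hf
  have haO : Y a ≠ (0, 0, 0) := fun h => hX a (ha ▸ h)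
  have hbO : Y b ≠ (0, 0, 0) := fun h => hX b (hb ▸ h)
  exact hA.atMostOne hY hf (fun h => haO (by rw [h]; exact hf)) (fun h => hbO (by rw [h]; exact hf)) hab haO hbO

/-- THEOREM X∞ on 𝔅(μ₄), the half proved in this file: a cell of an admissible configuration is JUNK (at most one charged
factor) OR FULLY CHARGED. (`Pad4TowerXInfMu4` removes the second alternative.) -/
theorem AdmissibleMu4.junk_or_fc {C : MConfig} (hA : AdmissibleMu4 C) {X : MCell} (hX : X ∈ C.lower ∨ X ∈ C.upper) :
    (∃ j, ∀ g, g ≠ j → X g = (0, 0, 0)) ∨ FCMu4 X := by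
  by_cases hfc : FCMu4 X
  · exact Or.inr hfc
  · left
    obtain ⟨f, hf⟩ : ∃ f, X f = (0, 0, 0) := by
      by_contra h
      push Not at h
      exact hfc h
    by_cases hch : ∃ j, X j ≠ (0, 0, 0)
    · obtain ⟨j, hj⟩ := hch
      refine ⟨j, fun g hgj => ?_⟩
      by_contra hg
      exact hA.atMostOne hX hf (fun h => hj (by rw [h]; exact hf)) (fun h => hg (by rw [h]; exact hf)) (Ne.symm hgj) hj hg
    · push Not at hch
      exact ⟨f, fun g _ => hch g⟩

end Summit.Ventures.HSemireg.Pad4Tower
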